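import Summits.QuantumFields.YangMills.Theorems.CentreWallReflectionSlabEven
import HarnessLib

/-!
# Slab decomposition of the four-torus Wilson weight, VII: the semigroup property `Ψ_{j+k} = Ψ_j ∗ Ψ_k`
# (crux `CentreWallReflection.WallReflection` ⟨stmt-QuantumFields-23707⟩, line `birth`, stub `stub_instantiate`; planner ym-idea-4 g18)

Three-slice gluing: `S_{[0,j+k]} = S_{[0,j]} + S_{[0,k]} ∘ τ_j`, the two pieces read disjoint link blocks, hence
`Ψ_{j+k}(X,A) = ∫ Ψ_j(X,B) Ψ_k(B,A) dπ(B)` (`j, k ≥ 1`, `j + k ≤ n`) — used on odd tori to write `Ψ_{m+1} = Ψ_1 ∗ Ψ_m`.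
HONEST FRAMING: lattice bookkeeping toward ONE crux of a draft route (fixed torus, finite lattice); nothing here proves the route's target
`MarginalTwistOnset.FixedTorusCriterionFailure`, any continuum statement, or the Yang–Mills mass gap.  THEOREMS ONLY (no `def`, no `sorry`),
standard axioms.  References: [cite: OsterwalderSeiler1978, §2]; [cite: tHooft1979]; E. T. Tomboulis, L. G. Yaffe, CMP 100 (1985) 313;
[cite: Luscher1983, §2].
-/

set_option autoImplicit false

noncomputable section

open scoped BigOperators
open MeasureTheory Literature.MathematicalPhysics.QuantumFieldTheory

namespace Summit.QuantumFields.YangMills.Theorems.CentreWallReflection.Slab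

open MeasureTheory
open Literature.MathematicalPhysics.QuantumFieldTheory.LatticeRP (splice measurePreserving_splice measurable_splice)

/-! ## §18 The semigroup property `Ψ_{j+k} = Ψ_j ∗ Ψ_k` -/

section Semigroup

variable {n : ℕ} {G : Type*} [Group G] {N : ℕ} (ρ : G →* Matrix (Fin N) (Fin N) ℂ) (μ : Fin 4)

/-- The weights of `[0, j+k]` split into those of `[0, j]` and the translated `[0, k]` (`j, k ≥ 1`, `j + k ≤ n`). -/
theorem slabWeight_add_eq {j k : ℕ} (hj1 : 1 ≤ j) (hk1 : 1 ≤ k) (hjk : j + k ≤ n) (p : Plaquette 4 (n + 1)) :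
    slabWeight μ (j + k) p = slabWeight μ j p + slabWeight μ k ((plaqShift μ (j : ZMod (n + 1))).symm p) := by
  have hval : (((plaqShift μ (j : ZMod (n + 1))).symm p).1 μ).val =
      if j ≤ (p.1 μ).val then (p.1 μ).val - j else (p.1 μ).val + (n + 1) - j := by
    rw [plaqShift_symm_apply_fst, Pi.sub_apply, Pi.single_eq_same, val_sub_natCast _ (by omega)]
  have htemp : isTemporal μ ((plaqShift μ (j : ZMod (n + 1))).symm p) = isTemporal μ p := rfl
  have ht : (p.1 μ).val < n + 1 := ZMod.val_lt _
  unfold slabWeight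
  simp only [htemp, hval]
  by_cases hT : isTemporal μ p = true
  · simp only [hT, if_true]
    split_ifs <;> norm_num <;> omega
  · simp only [hT]
    split_ifs <;> norm_num <;> omega

/-- The corresponding splitting of the slab action. -/
theorem slabAction_add_eq {j k : ℕ} (hj1 : 1 ≤ j) (hk1 : 1 ≤ k) (hjk : j + k ≤ n) (W : GaugeConfig 4 (n + 1) G) :
    slabAction ρ μ (j + k) W = slabAction ρ μ j W + slabAction ρ μ k (translate μ (j : ZMod (n + 1)) W) := by
  unfold slabAction
  have hre : ∑ p : Plaquette 4 (n + 1), slabWeight μ k p * plaqCost ρ (translate μ (j : ZMod (n + 1)) W) p =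
      ∑ p : Plaquette 4 (n + 1), slabWeight μ k ((plaqShift μ (j : ZMod (n + 1))).symm p) * plaqCost ρ W p := by
    rw [← Equiv.sum_comp (plaqShift μ (j : ZMod (n + 1))).symm]
    refine Finset.sum_congr rfl fun p _ => ?_
    congr 1
    simp only [plaqCost, plaquetteHolonomy_translate, plaqShift_symm_apply_fst, sub_add_cancel]
    rfl
  rw [hre, ← Finset.sum_add_distrib]
  refine Finset.sum_congr rfl fun p _ => ?_
  rw [← add_mul, slabWeight_add_eq μ hj1 hk1 hjk]

omit [Group G] in
/-- The three-slice configuration: slices `0 ← X`, `j ← B`, `j + k ← A`, the rest from `U`. -/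
theorem glue_splice_eq {j k : ℕ} (U X A B : GaugeConfig 4 (n + 1) G) :
    glue μ (j + k) (splice (sliceEdges μ (j : ZMod (n + 1))) (U, translate μ (-(j : ZMod (n + 1))) B)) X A =
      fun e => if e.2 ≠ μ ∧ e.1 μ = 0 then X e
        else if e.2 ≠ μ ∧ e.1 μ = ((j + k : ℕ) : ZMod (n + 1)) then A (e.1 - Pi.single μ ((j + k : ℕ) : ZMod (n + 1)), e.2)
        else if e.2 ≠ μ ∧ e.1 μ = (j : ZMod (n + 1)) then B (e.1 - Pi.single μ (j : ZMod (n + 1)), e.2)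
        else U e := by
  funext e
  unfold glue
  simp only [Literature.MathematicalPhysics.QuantumFieldTheory.LatticeRP.splice_apply, mem_sliceEdges, translate_apply, Pi.single_neg,
    ← sub_eq_add_neg]

omit [Group G] in
/-- `natCast_ne_natCast_of_lt` (slab bookkeeping, see the module docstring). -/
theorem natCast_ne_natCast_of_lt {a b : ℕ} (hab : a < b) (hb : b ≤ n) : ((a : ℕ) : ZMod (n + 1)) ≠ ((b : ℕ) : ZMod (n + 1)) := by
  intro h
  have := (ZMod.natCast_eq_natCast_iff' a b (n + 1)).mp h
  rw [Nat.mod_eq_of_lt (by omega), Nat.mod_eq_of_lt (by omega)] at this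
  omega

/-- On the slab `[0, j]`, the three-slice configuration agrees with `glue_j U X B`. -/
theorem slabAction_threeSlice_low {j k : ℕ} (hj1 : 1 ≤ j) (hk1 : 1 ≤ k) (hjk : j + k ≤ n) (U X A B : GaugeConfig 4 (n + 1) G) :
    slabAction ρ μ j (glue μ (j + k) (splice (sliceEdges μ (j : ZMod (n + 1))) (U, translate μ (-(j : ZMod (n + 1))) B)) X A) =
      slabAction ρ μ j (glue μ j U X B) := by
  rw [glue_splice_eq]
  refine dependsOn_slabAction ρ μ (by omega : j ≤ n) fun e he => ?_
  rw [Finset.mem_coe, mem_slabEdges] at he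
  have hjk' : ((j : ℕ) : ZMod (n + 1)) ≠ ((j + k : ℕ) : ZMod (n + 1)) := natCast_ne_natCast_of_lt (by omega) hjk
  have h0jk : (0 : ZMod (n + 1)) ≠ ((j + k : ℕ) : ZMod (n + 1)) := by
    rw [← Nat.cast_zero]; exact natCast_ne_natCast_of_lt (by omega) hjk
  unfold glue
  by_cases h2 : e.2 = μ
  · simp [h2]
  · simp only [h2, ne_eq, not_false_eq_true, true_and, if_neg] at he ⊢
    by_cases h0 : e.1 μ = 0
    · simp [h0]
    · by_cases hj : e.1 μ = (j : ZMod (n + 1))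
      · have hne : ¬ e.1 μ = ((j + k : ℕ) : ZMod (n + 1)) := by rw [hj]; exact hjk'
        simp only [if_neg h0, if_neg hne, if_pos hj]
      · have hne : e.1 μ ≠ ((j + k : ℕ) : ZMod (n + 1)) := by
          intro h
          have hv : (e.1 μ).val = j + k := by rw [h, ZMod.val_natCast, Nat.mod_eq_of_lt (by omega)]
          omega
        simp only [if_neg h0, if_neg hne, if_neg hj]

/-- On the translated slab `[j, j+k]`, the three-slice configuration agrees with `glue_k (τ_j U) B A`. -/
theorem slabAction_threeSlice_high {j k : ℕ} (hj1 : 1 ≤ j) (hk1 : 1 ≤ k) (hjk : j + k ≤ n) (U X A B : GaugeConfig 4 (n + 1) G) :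
    slabAction ρ μ k (translate μ (j : ZMod (n + 1))
        (glue μ (j + k) (splice (sliceEdges μ (j : ZMod (n + 1))) (U, translate μ (-(j : ZMod (n + 1))) B)) X A)) =
      slabAction ρ μ k (glue μ k (translate μ (j : ZMod (n + 1)) U) B A) := by
  rw [glue_splice_eq]
  refine dependsOn_slabAction ρ μ (by omega : k ≤ n) fun e he => ?_
  rw [Finset.mem_coe, mem_slabEdges] at he
  have hjv : ((j : ZMod (n + 1))).val = j := by rw [ZMod.val_natCast, Nat.mod_eq_of_lt (by omega)]
  simp only [translate_apply]
  unfold glue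
  simp only [Pi.add_apply, Pi.single_eq_same]
  by_cases h2 : e.2 = μ
  · simp [h2]
  · rw [if_neg h2] at he
    simp only [h2, ne_eq, not_false_eq_true, true_and]
    -- the level of `e + j e_μ` is `level(e) + j ∈ [j, j+k]`
    have hlev : (e.1 μ + (j : ZMod (n + 1))).val = (e.1 μ).val + j := by
      rw [ZMod.val_add, hjv, Nat.mod_eq_of_lt (by omega)]
    have hA : ¬ (e.1 μ + (j : ZMod (n + 1)) = 0) := by
      intro h; have := congrArg ZMod.val h; rw [hlev, ZMod.val_zero] at this; omega
    rw [if_neg hA]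
    by_cases hk : e.1 μ = (k : ZMod (n + 1))
    · have hB : e.1 μ + (j : ZMod (n + 1)) = ((j + k : ℕ) : ZMod (n + 1)) := by rw [hk]; push_cast; ring
      have hk0 : ¬ e.1 μ = 0 := by
        rw [hk]; exact natCast_ne_zero_of_le (n := n) k hk1 (by omega)
      rw [if_pos hB, if_neg hk0, if_pos hk]
      congr 2
      rw [Nat.cast_add, Pi.single_add]; abel
    · have hB : ¬ (e.1 μ + (j : ZMod (n + 1)) = ((j + k : ℕ) : ZMod (n + 1))) := by
        intro h; apply hk
        have : e.1 μ = ((j + k : ℕ) : ZMod (n + 1)) - (j : ZMod (n + 1)) := by rw [← h, add_sub_cancel_right]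
        rw [this]; push_cast; ring
      rw [if_neg hB]
      by_cases h0 : e.1 μ = 0
      · have hC : e.1 μ + (j : ZMod (n + 1)) = (j : ZMod (n + 1)) := by rw [h0, zero_add]
        rw [if_pos hC, if_pos h0]
        simp only [add_sub_cancel_right]
      · have hC : ¬ (e.1 μ + (j : ZMod (n + 1)) = (j : ZMod (n + 1))) := fun h => h0 (by simpa using h)
        rw [if_neg hC, if_neg h0, if_neg hk, translate_apply]

end Semigroup

section SemigroupMeasure

variable {n : ℕ} {G : Type*} [Group G] [TopologicalSpace G] [IsTopologicalGroup G] [CompactSpace G]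
  [MeasurableSpace G] [BorelSpace G] [SecondCountableTopology G] {N : ℕ} (ρ : G →* Matrix (Fin N) (Fin N) ℂ) (μ : Fin 4)


omit [Group G] [TopologicalSpace G] [IsTopologicalGroup G] [CompactSpace G] [MeasurableSpace G] [BorelSpace G] [SecondCountableTopology G] in
/-- `U ↦ f (translate μ j U)` depends on the translated coordinate set. -/
theorem dependsOn_translate {β : Type*} {f : (GaugeConfig 4 (n + 1) G) → β} {S : Finset (Edge 4 (n + 1))} (hf : DependsOn f (S : Set (Edge 4 (n + 1))))
    (j : ZMod (n + 1)) : DependsOn (fun U => f (translate μ j U)) ((S.map (edgeShift μ j).toEmbedding : Finset _) : Set (Edge 4 (n + 1))) := by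
  intro U V hUV
  apply hf
  intro e he
  simp only [translate_apply]
  exact hUV _ (by
    rw [Finset.coe_map]
    exact ⟨e, he, rfl⟩)

/-- **Semigroup property**: `Ψ_{j+k}(X, A) = ∫ Ψ_j(X, B) Ψ_k(B, A) dπ(B)` for `j, k ≥ 1`, `j + k ≤ n`. -/
theorem slabKernel_add (hρ : Continuous ρ) (hU : ∀ g, ρ g ∈ Matrix.unitaryGroup (Fin N) ℂ) {β : ℝ} (hβ : 0 ≤ β)
    {j k : ℕ} (hj1 : 1 ≤ j) (hk1 : 1 ≤ k) (hjk : j + k ≤ n) (X A : (GaugeConfig 4 (n + 1) G)) :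
    slabKernel ρ μ β (j + k) X A = ∫ B, slabKernel ρ μ β j X B * slabKernel ρ μ β k B A ∂(MeasureTheory.Measure.pi (fun _ : Edge 4 (n + 1) => haarProbability G)) := by
  unfold slabKernel
  set F : (GaugeConfig 4 (n + 1) G) → ℝ := fun U => Real.exp (-(β * slabAction ρ μ (j + k) (glue μ (j + k) U X A))) with hF
  have hFm : Measurable F := Real.continuous_exp.measurable.comp
    ((((continuous_slabAction ρ μ hρ (j + k)).measurable.comp (measurable_glue_left μ (j + k) X A)).const_mul β).neg)
  have hFb : ∀ U, |F U| ≤ 1 := fun U => abs_exp_neg_le_one hβ (slabAction_nonneg ρ μ hU _ _)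
  -- insert the slice-j variable
  rw [integral_splice (sliceEdges μ (j : ZMod (n + 1))) hFm hFb]
  have h1 : Integrable (Function.uncurry fun (U Y : (GaugeConfig 4 (n + 1) G)) => F (splice (sliceEdges μ (j : ZMod (n + 1))) (U, Y))) (((MeasureTheory.Measure.pi (fun _ : Edge 4 (n + 1) => haarProbability G))).prod (MeasureTheory.Measure.pi (fun _ : Edge 4 (n + 1) => haarProbability G))) :=
    Integrable.of_bound ((hFm.comp (measurable_splice _)).aestronglyMeasurable) 1
      (ae_of_all _ fun p => by rw [Real.norm_eq_abs]; exact hFb _)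
  rw [integral_integral_swap h1]
  -- translate the slice-j variable
  have hm : Measurable fun Y : (GaugeConfig 4 (n + 1) G) => ∫ U, F (splice (sliceEdges μ (j : ZMod (n + 1))) (U, Y)) ∂(MeasureTheory.Measure.pi (fun _ : Edge 4 (n + 1) => haarProbability G)) := by
    have hm2 : Measurable (Function.uncurry fun (Y U : (GaugeConfig 4 (n + 1) G)) => F (splice (sliceEdges μ (j : ZMod (n + 1))) (U, Y))) :=
      hFm.comp ((measurable_splice _).comp (measurable_snd.prodMk measurable_fst))
    exact (hm2.stronglyMeasurable.integral_prod_right' (ν := (MeasureTheory.Measure.pi (fun _ : Edge 4 (n + 1) => haarProbability G)))).measurable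
  rw [← integral_comp_mp (measurePreserving_translate μ (-(j : ZMod (n + 1)))) hm]
  refine integral_congr_ae (ae_of_all _ fun B => ?_)
  dsimp only
  -- factorise the integrand
  have hsplit : ∀ U : (GaugeConfig 4 (n + 1) G), F (splice (sliceEdges μ (j : ZMod (n + 1))) (U, translate μ (-(j : ZMod (n + 1))) B)) =
      Real.exp (-(β * slabAction ρ μ j (glue μ j U X B))) *
        Real.exp (-(β * slabAction ρ μ k (glue μ k (translate μ (j : ZMod (n + 1)) U) B A))) := by
    intro U
    simp only [hF]
    rw [slabAction_add_eq ρ μ hj1 hk1 hjk, slabAction_threeSlice_low ρ μ hj1 hk1 hjk, slabAction_threeSlice_high ρ μ hj1 hk1 hjk,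
      mul_add, neg_add, Real.exp_add]
  simp_rw [hsplit]
  have hright : ∫ U, Real.exp (-(β * slabAction ρ μ k (glue μ k (translate μ (j : ZMod (n + 1)) U) B A))) ∂(MeasureTheory.Measure.pi (fun _ : Edge 4 (n + 1) => haarProbability G)) =
      ∫ U, Real.exp (-(β * slabAction ρ μ k (glue μ k U B A))) ∂(MeasureTheory.Measure.pi (fun _ : Edge 4 (n + 1) => haarProbability G)) :=
    integral_comp_mp (measurePreserving_translate μ (j : ZMod (n + 1)))
      (Φ := fun V : (GaugeConfig 4 (n + 1) G) => Real.exp (-(β * slabAction ρ μ k (glue μ k V B A))))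
      ((Real.continuous_exp.measurable).comp ((((continuous_slabAction ρ μ hρ k).measurable.comp
        (measurable_glue_left μ k B A)).const_mul β).neg))
  rw [← hright]
  refine integral_mul_of_dependsOn (slabInterior μ j) ((slabInterior μ k).map (edgeShift μ (j : ZMod (n + 1))).toEmbedding) ?_ ?_ ?_ ?_ ?_
  · rw [Finset.disjoint_left]
    intro e he1 he2
    rw [Finset.mem_map] at he2
    obtain ⟨e', he', rfl⟩ := he2
    rw [mem_slabInterior] at he1 he'
    have hjv : ((j : ZMod (n + 1))).val = j := by rw [ZMod.val_natCast, Nat.mod_eq_of_lt (by omega)]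
    have hlev : ((edgeShift μ (j : ZMod (n + 1))).toEmbedding e').1 μ = e'.1 μ + (j : ZMod (n + 1)) := by
      show ((e'.1 + Pi.single μ (j : ZMod (n + 1)) : Site 4 (n + 1)) μ) = _
      rw [Pi.add_apply, Pi.single_eq_same]
    have h2 : ((edgeShift μ (j : ZMod (n + 1))).toEmbedding e').2 = e'.2 := rfl
    rw [hlev, h2] at he1
    have hv : (e'.1 μ + (j : ZMod (n + 1))).val = (e'.1 μ).val + j := by
      rw [ZMod.val_add, hjv, Nat.mod_eq_of_lt]
      split_ifs at he' <;> omega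
    rw [hv] at he1
    split_ifs at he1 he' <;> omega
  · exact Real.continuous_exp.measurable.comp ((((continuous_slabAction ρ μ hρ j).measurable.comp
      (measurable_glue_left μ j X B)).const_mul β).neg)
  · exact Real.continuous_exp.measurable.comp ((((continuous_slabAction ρ μ hρ k).measurable.comp
      ((measurable_glue_left μ k B A).comp (measurePreserving_translate μ (j : ZMod (n + 1))).measurable)).const_mul β).neg)
  · have h := dependsOn_glue_of_dependsOn μ (dependsOn_comp (dependsOn_slabAction ρ μ (by omega : j ≤ n)) fun s => Real.exp (-(β * s))) j X B
    exact h.mono (by exact_mod_cast slabEdges_filter_subset_interior μ j)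
  · have h := dependsOn_glue_of_dependsOn μ (dependsOn_comp (dependsOn_slabAction ρ μ (by omega : k ≤ n)) fun s => Real.exp (-(β * s))) k B A
    have h' : DependsOn (fun U : (GaugeConfig 4 (n + 1) G) => Real.exp (-(β * slabAction ρ μ k (glue μ k U B A))))
        ((slabInterior μ k : Finset (Edge 4 (n + 1))) : Set (Edge 4 (n + 1))) :=
      h.mono (by exact_mod_cast slabEdges_filter_subset_interior μ k)
    exact dependsOn_translate μ h' (j : ZMod (n + 1))

end SemigroupMeasure

end Summit.QuantumFields.YangMills.Theorems.CentreWallReflection.Slab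

end
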